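import Mathlib
import HarnessLib
import Summits.HubbardSuperconductivity.HubbardSuperconductivity.Theorems.KLProgrammeKLRegimeBetaSplitEdgeF

/-!
# Route `KLProgramme` — crux K3 gen 8, CHILD 1 (`KLRegimeBetaSplitV17F2`, BetaSplitP) — the generic child-1 closer with a KL-REGIME-AWARE extra family:
# `betaSplitP_of_edgeClausesFZ` (rider of located #27's cure «Z-slot», KL STATUS (R675), pre-paid on the current texts)

Cell gate-hubbard-kl, seat hubbard-kl-k3c1-p1 (g28; child-1 lineage; technique «composed-map remainder propagation»).  Context: located #27
«(c)-IN-Z-DRESSED-SLICE» (binder #8 of the ENGINE pin, stmt-HubbardSuperconductivity-20437) was ruled ON-conditional with cure «Z-slot» = a registry edit adding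
ONE n-FLAT higher-order in-class slot `σ_Z·(P.Klam·U)⁴` to the (E2-F2) bar, with the RIDER «child 1 (β-split, closed on `klPredsV17F2` by
`betaSplitP_of_edgeClausesF`/`betaSplitP_of_slotsV17F2`, p-landed) re-closed on the edited text» — priced «by value harmless [est]; child 1's constants to be
checked at edit time».  An n-flat per-scale term is NOT summable under the premises the landed closer hands to its extra family (`n ≤ nScales β` only): its window
sum `σ·Klam⁴·U⁴·n` is small only through the KL-regime line `U²·n·ln 4 ≤ c` (`IsKLRegime U c (−n)`), which `BetaSplitP` holds at the point of use but
`betaSplitP_of_edgeClausesF` does not pass on.  This file is that closer with exactly this interface widened and NOTHING else changed: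

* the per-scale clause `h𝔛sup` may use a caller U-cap `U ≤ uX G P Q`; the two scale-sum clauses `h𝔛sum`/`h𝔛tot` may use `U ≤ uX G P Q`, the regime constant `c`
  with `0 < c ≤ cX G P Q` (a caller c-cap) and `IsKLRegime U c (−n)`; `uX, cX > 0` on well-formed packages;
* the no-onset constant becomes `c₀ := min(ln 4/(336·Crow·(bhi+1)), cX G P Q)` and the threshold `U₀ := min(…, uR R, uX G P Q)` — legitimate because `BetaSplitP`
  chooses `c₀` after `G P Q` and `U₀` after `R`;
* all numerals, the constants `Klam = 2CF+3`, `C_W`, `Cd`, the leg line `12(tQ+sQ)+tQ ≤ klLegKappa`, row 0′ (`pairArrayAtV17F_of_edgeClauses_explicit`) and the per-scale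
  step are byte-identical (the proof is p-landed `betaSplitP_of_edgeClausesF`'s with the four extra premises threaded to the two call sites).

The slot-level instance with the flat slot `κ·Q.CR·(P.Klam·U)⁴` (`betaSplitP_of_clausesV17F2Z`, numerals `(3, 10, 10/3, 151/3, 15)`, `uX = 1/(κ·Klam+1)`,
`cX = ln 4/(κ·Klam+1)`) is the next file.  Everything is proved; no definitions; nothing about the model is asserted (the engine/renorm slots are hypotheses of child 1
by the route's design); no registered text is edited here; nothing asserts superconductivity.
-/

noncomputable section

namespace Summit.HubbardSuperconductivity.HubbardSuperconductivity.Theorems.KLRegimeSplit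

set_option linter.dupNamespace false -- summit = problem name (single-conjunct summit), D-0017

open Real Finset Literature.MathematicalPhysics.QuantumLattice Literature.Probability.LatticeModels
open Summit.HubbardSuperconductivity.HubbardSuperconductivity.Theorems.KLProgrammeLegKernels
open Summit.HubbardSuperconductivity.HubbardSuperconductivity.Theorems.CooperChannelRiccatiFlow
open Summit.HubbardSuperconductivity.HubbardSuperconductivity.Theorems.DispersionFlow

/-- **Child 1 for every bundle and window in scheme F-II, KL-regime-aware extra family** (twin of `betaSplitP_of_edgeClausesF`): SIGNED ladder weights with no
net-mass floor, generic in the extra family and the sign-defect allowance.  Numerals `sG sQ tG tQ tN ≥ 0` with `12(tQ+sQ)+tQ ≤ klLegKappa`; an `R`-level smallness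
`uR R > 0` and a `(G,P,Q)`-level smallness `uX G P Q > 0` for `U` (both folded into `U₀`); a `(G,P,Q)`-level cap `cX G P Q > 0` for the regime constant (folded into
`c₀`); the extra family `𝔛 L M G P Q β U μ j Qm k k′` with the per-scale bound under `U ≤ uX G P Q` and SCALE-SUM bounds that may use `R.WF`, `U ≤ uR R`,
`U ≤ uX G P Q`, `0 < c ≤ cX G P Q`, the KL-regime line `IsKLRegime U c (−n)` (`U²·n·ln 4 ≤ c` — the only summability an n-flat slot has) and the HISTORY
`HistP Pr … n`; a sign-defect allowance `𝔑` with in-class scale sums `≤ tN·(bhi+1)`; a bundle whose split slot is implied by `BetaSplitAtV17F` and whose engine slot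
yields the (E2-F2)₀ UV clause, the SIGNED (E2-F2) ladder clause and the (E2″-F) increment clause around `𝔛`, (E4) at `K_n` and (E5-F).  THEN `BetaSplitP Pr W`.
Constants as in `betaSplitP_of_edgeClausesF` (`Klam = 2CF+3`, `C_W`, `Cd = cE4+1`) except `c₀ = min(ln 4/(336·Crow·(bhi+1)), cX G P Q)`, `U₀ = min(…, uR R, uX G P Q)`. -/
theorem betaSplitP_of_edgeClausesFZ {Pr : Preds} {W : Set ℝ} {sG sQ tG tQ tN : ℝ} (hsG : 0 ≤ sG) (hsQ : 0 ≤ sQ) (htG : 0 ≤ tG)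
    (htQ : 0 ≤ tQ) (htN : 0 ≤ tN) (hκ : 12 * (tQ + sQ) + tQ ≤ klLegKappa) (uR : RenConsts → ℝ) (huR : ∀ R : RenConsts, R.WF → 0 < uR R)
    (uX cX : GeoConsts → SplitConsts → EngConsts → ℝ)
    (huX : ∀ (G : GeoConsts) (P : SplitConsts) (Q : EngConsts), G.WF → P.WF → Q.WF → 0 < uX G P Q)
    (hcX : ∀ (G : GeoConsts) (P : SplitConsts) (Q : EngConsts), G.WF → P.WF → Q.WF → 0 < cX G P Q)
    (𝔛 : ∀ (L M : ℕ) [NeZero L] [NeZero M], GeoConsts → SplitConsts → EngConsts → ℝ → ℝ → ℝ → ℕ →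
      TorusSite 2 L → TorusSite 2 L → TorusSite 2 L → ℝ)
    (h𝔛0 : ∀ (L M : ℕ) [NeZero L] [NeZero M] (G : GeoConsts) (P : SplitConsts) (Q : EngConsts) (β U μ : ℝ) (j : ℕ)
      (Qm k k' : TorusSite 2 L), G.WF → P.WF → Q.WF → 0 ≤ 𝔛 L M G P Q β U μ j Qm k k')
    (h𝔛sup : ∀ (L M : ℕ) [NeZero L] [NeZero M] (G : GeoConsts) (P : SplitConsts) (Q : EngConsts) (β U μ : ℝ) (j : ℕ)
      (Qm k k' : TorusSite 2 L), G.WF → P.WF → Q.WF → 0 ≤ U → |U| ≤ 1 → U ≤ uX G P Q →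
        𝔛 L M G P Q β U μ j Qm k k' ≤ sG * (G.CF * (P.Klam * U) ^ 2) + sQ * (Q.CR * P.Klam ^ 3 * U ^ 2))
    (h𝔛sum : ∀ (L M : ℕ) [NeZero L] [NeZero M] (G : GeoConsts) (P : SplitConsts) (Q : EngConsts) (R : RenConsts) (β U μ : ℝ)
      (K : TrigPolyC4v) (t n : ℕ) (Qm k k' : TorusSite 2 L) (c : ℝ), G.WF → P.WF → Q.WF → R.WF → 0 ≤ U → |U| ≤ 1 → U ≤ uR R → U ≤ uX G P Q →
        0 < c → c ≤ cX G P Q → n ≤ nScales β → IsKLRegime U c (-(n : ℤ)) →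
        HistP Pr L M G P Q R β U μ K n →
        ∑ j ∈ Ioc t n, 𝔛 L M G P Q β U μ j Qm k k' ≤ tG * (G.CF * (P.Klam * U) ^ 2) + tQ * (Q.CR * P.Klam ^ 3 * U ^ 2))
    (h𝔛tot : ∀ (L M : ℕ) [NeZero L] [NeZero M] (G : GeoConsts) (P : SplitConsts) (Q : EngConsts) (R : RenConsts) (β U μ : ℝ)
      (K : TrigPolyC4v) (n : ℕ) (Qm k k' : TorusSite 2 L) (c : ℝ), G.WF → P.WF → Q.WF → R.WF → 0 ≤ U → |U| ≤ 1 → U ≤ uR R → U ≤ uX G P Q →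
        0 < c → c ≤ cX G P Q → n ≤ nScales β → IsKLRegime U c (-(n : ℤ)) →
        HistP Pr L M G P Q R β U μ K n →
        𝔛 L M G P Q β U μ 0 Qm k k' + ∑ i ∈ range n, 𝔛 L M G P Q β U μ (i + 1) Qm k k' ≤
          tG * (G.CF * (P.Klam * U) ^ 2) + tQ * (Q.CR * P.Klam ^ 3 * U ^ 2))
    (𝔑 : ∀ (L : ℕ), GeoConsts → SplitConsts → EngConsts → ℝ → ℝ → ℝ → ℕ → TorusSite 2 L → ℝ)
    (h𝔑sum : ∀ (L : ℕ) (G : GeoConsts) (P : SplitConsts) (Q : EngConsts) (β U μ : ℝ) (t : ℕ) (Qm : TorusSite 2 L),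
      G.WF → P.WF → Q.WF → 0 ≤ U → |U| ≤ 1 → t ≤ nScales β → IsPairClassAt L Qm t →
        ∑ i ∈ range t, 𝔑 L G P Q β U μ (i + 1) Qm ≤ tN * (G.bhi + 1))
    (hs : ∀ (L M : ℕ) [NeZero L] [NeZero M] (G : GeoConsts) (P : SplitConsts) (Q : EngConsts) (β U μ : ℝ) (K : TrigPolyC4v) (n : ℕ),
      BetaSplitAtV17F L M G P Q β U μ n → Pr.split L M G P Q β U μ K n)
    (he : ∀ (L M : ℕ) [NeZero L] [NeZero M] (G : GeoConsts) (P : SplitConsts) (Q : EngConsts) (β U μ : ℝ) (K : TrigPolyC4v) (n : ℕ),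
      Pr.engine L M G P Q β U μ K n →
        (n = 0 → ∀ Qm : TorusSite 2 L, ∀ k ∈ klBall L μ 0, ∀ k' ∈ klBall L μ 0,
          ‖klPairAmplitude L M β U μ (klFlowFrameU L M β U μ 0) 0 Qm k k' - (U : ℂ)‖ ≤ initDevBar G U + 𝔛 L M G P Q β U μ 0 Qm k k') ∧
        (1 ≤ n → ∀ Qm : TorusSite 2 L, IsPairClassAt L Qm n →
          ∃ w : TorusSite 2 L → ℝ, (∑ p, |w p| ≤ G.bhi) ∧ (∑ p, (|w p| - w p) ≤ 𝔑 L G P Q β U μ n Qm) ∧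
            ∃ N : Matrix (TorusSite 2 L) (TorusSite 2 L) ℂ,
              (1 + Matrix.diagonal (fun p => (w p : ℂ)) * klPairArrayF L M β U μ (n - 1) Qm) * N = 1 ∧
              ∀ k ∈ klBall L μ 0, ∀ k' ∈ klBall L μ 0,
                ‖klPairAmplitude L M β U μ (klFlowFrameU L M β U μ n) n Qm k k' - (klPairArrayF L M β U μ (n - 1) Qm * N) k k'‖ ≤
                  drivePBar G P U (n - 1) + eremBar G P Q U β L (n - 1) + 𝔛 L M G P Q β U μ n Qm k k') ∧
        (1 ≤ n → ∀ Qm : TorusSite 2 L, ∀ k ∈ klBall L μ 0, ∀ k' ∈ klBall L μ 0,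
          ‖klPairAmplitude L M β U μ (klFlowFrameU L M β U μ n) n Qm k k' - klPairAmplitude L M β U μ (klFlowFrameU L M β U μ (n - 1)) (n - 1) Qm k k'‖ ≤
            gainBar G P U n (klTorusNorm L Qm) (klTorusNorm L (k - k')) (klTorusNorm L (k + k' - Qm)) +
              eremBar G P Q U β L (n - 1) + 𝔛 L M G P Q β U μ n Qm k k') ∧
        EngineFirstMoments L M G P Q β U μ (klFlowFrameU L M β U μ n) n ∧ IsoTupleL1AtV17F L M G P β U μ n) :
    BetaSplitP Pr W := by
  intro G hG
  -- nonnegativity of the `G`-constants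
  have hCF : 0 ≤ G.CF := hG.2.2.2.2.2.2.2.2.2.2.2.2.2.1
  have hcloc : 0 ≤ G.cloc := hG.2.2.2.2.1
  have haplus : 0 ≤ G.aplus := hG.2.2.2.2.2.2.2.2.2.2.1
  have hθ : 0 < G.θ := hG.2.2.2.2.2.1
  have hbhi : 0 ≤ G.bhi := le_trans hG.2.2.1 hG.2.2.2.1
  have hcE4 : 0 ≤ G.cE4 := hG.2.2.2.2.2.2.2.2.2.2.2.2.2.2.2.2.1
  have hZ : 0 ≤ G.Z := le_trans (sum_nonneg fun j _ => hG.2.2.2.2.2.2.2.2.1 j) (hG.2.2.2.2.2.2.2.2.2.1 0)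
  have hab : 0 ≤ ∑ χ : D4Irrep, (G.abot χ + G.atop χ) := sum_nonneg fun χ _ => add_nonneg (hG.2.1 χ) (hG.1 χ)
  have hg : 0 ≤ (1 - (4 : ℝ) ^ (-G.θ))⁻¹ :=
    inv_nonneg.2 (by have := Real.rpow_lt_one_of_one_lt_of_neg (x := (4 : ℝ)) (by norm_num) (by linarith : -G.θ < 0); linarith)
  -- the induction constants `P` (kept opaque)
  obtain ⟨Klam, hKlam⟩ : ∃ x : ℝ, x = 2 * G.CF + 3 := ⟨_, rfl⟩
  have hKlam1 : 1 ≤ Klam := by rw [hKlam]; linarith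
  have hKlam0 : 0 ≤ Klam := zero_le_one.trans hKlam1
  have hK2 : 0 ≤ Klam ^ 2 := sq_nonneg _
  have hx1 : 0 ≤ G.aplus * Klam ^ 2 * G.Z := mul_nonneg (mul_nonneg haplus hK2) hZ
  have hx2 : 0 ≤ G.cloc * Klam ^ 2 * (1 - (4 : ℝ) ^ (-G.θ))⁻¹ := mul_nonneg (mul_nonneg hcloc hK2) hg
  have hnum : 0 ≤ 12 * (tG + sG) + 3 + tG := by positivity
  obtain ⟨CW, hCW⟩ : ∃ x : ℝ, x = 12 * (∑ χ : D4Irrep, (G.abot χ + G.atop χ) + 1) +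
      25 * (G.aplus * Klam ^ 2 * G.Z + G.cloc * Klam ^ 2 * (1 - (4 : ℝ) ^ (-G.θ))⁻¹ + 1) + 2 +
        (12 * (tG + sG) + 3 + tG) * (G.CF * Klam ^ 2) := ⟨_, rfl⟩
  have hCW0 : 0 ≤ CW := by rw [hCW]; positivity
  refine ⟨⟨Klam, CW, G.cE4 + 1, 0⟩, ⟨hKlam1, hCW0, by positivity⟩, ?_⟩
  intro Q hQ
  have hPWF : (⟨Klam, CW, G.cE4 + 1, 0⟩ : SplitConsts).WF := ⟨hKlam1, hCW0, by positivity⟩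
  have hCR : 0 ≤ Q.CR := hQ.2.1
  have hQcE4 : 0 ≤ Q.cE4 := hQ.2.2.2.1
  have hCL : ∀ β n, 0 ≤ Q.CL β n := hQ.2.2.2.2.2.2.2
  -- the no-onset constant `c₀` (after `Q`: it reads `Q.CR`)
  obtain ⟨Crow, hCrow_def⟩ : ∃ x : ℝ, x = (∑ χ : D4Irrep, (G.abot χ + G.atop χ) + 1) +
      2 * (G.aplus * Klam ^ 2 * G.Z + G.cloc * Klam ^ 2 * (1 - (4 : ℝ) ^ (-G.θ))⁻¹ + 1) + 1 + (tG + sG) * (G.CF * Klam ^ 2) +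
        (tQ + sQ) * (Q.CR * Klam ^ 3) := ⟨_, rfl⟩
  have hK3 : 0 ≤ Q.CR * Klam ^ 3 := by positivity
  have hCrow1 : 1 ≤ Crow := by
    rw [hCrow_def]; nlinarith [mul_nonneg hCF hK2, mul_nonneg (add_nonneg htG hsG) (mul_nonneg hCF hK2),
      mul_nonneg (add_nonneg htQ hsQ) hK3]
  have hCrow : 0 ≤ Crow := zero_le_one.trans hCrow1
  have hlog4 : 0 < Real.log 4 := Real.log_pos (by norm_num)
  -- the no-onset constant reads `8·42 = 336 = 160·(21/10)`
  obtain ⟨Crow', hCrow'_def⟩ : ∃ x : ℝ, x = 21 / 10 * Crow := ⟨_, rfl⟩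
  have hCrow'pos : 0 < Crow' := by rw [hCrow'_def]; positivity
  have hCrow' : 0 ≤ Crow' := hCrow'pos.le
  have hcXpos : 0 < cX G (⟨Klam, CW, G.cE4 + 1, 0⟩ : SplitConsts) Q := hcX G _ Q hG hPWF hQ
  refine ⟨min (Real.log 4 / (160 * Crow' * (G.bhi + 1))) (cX G (⟨Klam, CW, G.cE4 + 1, 0⟩ : SplitConsts) Q), lt_min (by positivity) hcXpos, ?_⟩
  intro c hc hcmin R hR
  have hcc₀ : c ≤ Real.log 4 / (160 * Crow' * (G.bhi + 1)) := hcmin.trans (min_le_left _ _)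
  have hccX : c ≤ cX G (⟨Klam, CW, G.cE4 + 1, 0⟩ : SplitConsts) Q := hcmin.trans (min_le_right _ _)
  -- `U₀`
  obtain ⟨CW', hCW'_def⟩ : ∃ x : ℝ, x = CW + klLegKappa * Q.CR * Klam ^ 3 := ⟨_, rfl⟩
  have hκ0 : 0 ≤ klLegKappa := by unfold klLegKappa; norm_num
  have hCW'0 : 0 ≤ CW' := by
    rw [hCW'_def]; exact add_nonneg hCW0 (mul_nonneg (mul_nonneg hκ0 hCR) (pow_nonneg hKlam0 3))
  obtain ⟨Dval, hDval_def⟩ : ∃ x : ℝ, x = CW' + G.CF * CW' + G.CF * Klam ^ 2 := ⟨_, rfl⟩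
  have hDval : 0 ≤ Dval := by
    rw [hDval_def]; exact add_nonneg (add_nonneg hCW'0 (mul_nonneg hCF hCW'0)) (mul_nonneg hCF hK2)
  obtain ⟨U₀, hU₀_def⟩ : ∃ x : ℝ, x = min 1 (min (1 / (2 * Q.CR * Klam ^ 3 + 1)) (min (1 / (Q.cE4 + 1)) (min (1 / (Dval + 1))
      (min (1 / (16 * tN * (G.bhi + 1) + 1)) (min (uR R) (uX G (⟨Klam, CW, G.cE4 + 1, 0⟩ : SplitConsts) Q)))))) := ⟨_, rfl⟩
  have huXpos : 0 < uX G (⟨Klam, CW, G.cE4 + 1, 0⟩ : SplitConsts) Q := huX G _ Q hG hPWF hQ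
  have htNb : 0 ≤ 16 * tN * (G.bhi + 1) := by positivity
  have hU₀ : 0 < U₀ := by
    rw [hU₀_def]
    exact lt_min one_pos (lt_min (by positivity) (lt_min (by positivity) (lt_min (by positivity) (lt_min (by positivity)
      (lt_min (huR R hR) huXpos)))))
  refine ⟨U₀, hU₀, fun β U => ⌈17 * (∑ j ∈ range (nScales β + 1), Q.CL β j) / U ^ 2⌉₊, fun _ _ _ => 0, ?_⟩
  intro μ hμ U hU hUle β hβmin hβc K hK L M _ _ hL hM n hn hKL hHist hE hT
  -- the smallness lines out of `U ≤ U₀`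
  rw [hU₀_def] at hUle
  have hU1 : U ≤ 1 := hUle.trans (min_le_left _ _)
  have hUa : |U| = U := abs_of_pos hU
  have hUa1 : |U| ≤ 1 := by rw [hUa]; exact hU1
  have hUCR : 2 * Q.CR * Klam ^ 3 * |U| ≤ 1 := by
    rw [hUa]
    exact klbs_mul_le_one_of_le_inv (by positivity) hU.le (hUle.trans ((min_le_right _ _).trans (min_le_left _ _)))
  have hUcE4 : Q.cE4 * |U| ≤ 1 := by
    rw [hUa]
    exact klbs_mul_le_one_of_le_inv hQcE4 hU.le
      (hUle.trans ((min_le_right _ _).trans ((min_le_right _ _).trans (min_le_left _ _))))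
  have hUD : Dval * U ≤ 1 :=
    klbs_mul_le_one_of_le_inv hDval hU.le
      (hUle.trans ((min_le_right _ _).trans ((min_le_right _ _).trans ((min_le_right _ _).trans (min_le_left _ _)))))
  have hUN : 16 * tN * (G.bhi + 1) * U ≤ 1 :=
    klbs_mul_le_one_of_le_inv htNb hU.le
      (hUle.trans ((min_le_right _ _).trans ((min_le_right _ _).trans ((min_le_right _ _).trans ((min_le_right _ _).trans (min_le_left _ _))))))
  have hURX : U ≤ min (uR R) (uX G (⟨Klam, CW, G.cE4 + 1, 0⟩ : SplitConsts) Q) :=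
    hUle.trans ((min_le_right _ _).trans ((min_le_right _ _).trans ((min_le_right _ _).trans ((min_le_right _ _).trans (min_le_right _ _)))))
  have hUR : U ≤ uR R := hURX.trans (min_le_left _ _)
  have hUX : U ≤ uX G (⟨Klam, CW, G.cE4 + 1, 0⟩ : SplitConsts) Q := hURX.trans (min_le_right _ _)
  have hc' : 160 * Crow' * (G.bhi + 1) * c ≤ Real.log 4 := by
    have hpos : 0 < 160 * Crow' * (G.bhi + 1) := by positivity
    have := (le_div_iff₀ hpos).1 hcc₀
    linarith
  -- the engine clauses at every scale `j ≤ n` (history + the scale-`n` hypothesis)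
  have hEn := he L M G (⟨Klam, CW, G.cE4 + 1, 0⟩ : SplitConsts) Q β U μ K n hE
  have hEall : ∀ j ≤ n,
      (j = 0 → ∀ Qm : TorusSite 2 L, ∀ k ∈ klBall L μ 0, ∀ k' ∈ klBall L μ 0,
          ‖klPairAmplitude L M β U μ (klFlowFrameU L M β U μ 0) 0 Qm k k' - (U : ℂ)‖ ≤
            initDevBar G U + 𝔛 L M G (⟨Klam, CW, G.cE4 + 1, 0⟩ : SplitConsts) Q β U μ 0 Qm k k') ∧
        (1 ≤ j → ∀ Qm : TorusSite 2 L, IsPairClassAt L Qm j →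
          ∃ w : TorusSite 2 L → ℝ, (∑ p, |w p| ≤ G.bhi) ∧
            (∑ p, (|w p| - w p) ≤ 𝔑 L G (⟨Klam, CW, G.cE4 + 1, 0⟩ : SplitConsts) Q β U μ j Qm) ∧
            ∃ N : Matrix (TorusSite 2 L) (TorusSite 2 L) ℂ,
              (1 + Matrix.diagonal (fun p => (w p : ℂ)) * klPairArrayF L M β U μ (j - 1) Qm) * N = 1 ∧
              ∀ k ∈ klBall L μ 0, ∀ k' ∈ klBall L μ 0,
                ‖klPairAmplitude L M β U μ (klFlowFrameU L M β U μ j) j Qm k k' - (klPairArrayF L M β U μ (j - 1) Qm * N) k k'‖ ≤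
                  drivePBar G (⟨Klam, CW, G.cE4 + 1, 0⟩ : SplitConsts) U (j - 1) + eremBar G (⟨Klam, CW, G.cE4 + 1, 0⟩ : SplitConsts) Q U β L (j - 1) + 𝔛 L M G (⟨Klam, CW, G.cE4 + 1, 0⟩ : SplitConsts) Q β U μ j Qm k k') ∧
        (1 ≤ j → ∀ Qm : TorusSite 2 L, ∀ k ∈ klBall L μ 0, ∀ k' ∈ klBall L μ 0,
          ‖klPairAmplitude L M β U μ (klFlowFrameU L M β U μ j) j Qm k k' - klPairAmplitude L M β U μ (klFlowFrameU L M β U μ (j - 1)) (j - 1) Qm k k'‖ ≤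
            gainBar G (⟨Klam, CW, G.cE4 + 1, 0⟩ : SplitConsts) U j (klTorusNorm L Qm) (klTorusNorm L (k - k')) (klTorusNorm L (k + k' - Qm)) +
              eremBar G (⟨Klam, CW, G.cE4 + 1, 0⟩ : SplitConsts) Q U β L (j - 1) + 𝔛 L M G (⟨Klam, CW, G.cE4 + 1, 0⟩ : SplitConsts) Q β U μ j Qm k k') := by
    intro j hj
    rcases Nat.lt_or_ge j n with hlt | hge
    · have h := he L M G (⟨Klam, CW, G.cE4 + 1, 0⟩ : SplitConsts) Q β U μ K j (hHist j hlt).2.2.1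
      exact ⟨h.1, h.2.1, h.2.2.1⟩
    · have : j = n := le_antisymm hj hge
      subst this
      exact ⟨hEn.1, hEn.2.1, hEn.2.2.1⟩
  -- (B1-v2′) from the generic row 0′, in the regime
  have hLline : 17 * ∑ j ∈ range n, Q.CL β j / L ≤ U ^ 2 := klbs_volume_line hCL hU hn hL
  have hsmall : 8 * 42 * (((∑ χ : D4Irrep, (G.abot χ + G.atop χ) + 1) +
      2 * (G.aplus * Klam ^ 2 * G.Z + G.cloc * Klam ^ 2 * (1 - (4 : ℝ) ^ (-G.θ))⁻¹ + 1) + 1 + (tG + sG) * (G.CF * Klam ^ 2) +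
        (tQ + sQ) * (Q.CR * Klam ^ 3)) * U ^ 2) * (G.bhi * n) ≤ 1 := by
    rw [← hCrow_def]
    have h := klbs_noOnset_line hCrow' hbhi hKL hc'
    rw [hCrow'_def] at h
    linarith
  -- the negative-mass line at every pair-class scale `t ≤ n`
  have hnegline : ∀ Qm : TorusSite 2 L, ∀ t ≤ n, IsPairClassAt L Qm t →
      16 * U * ∑ i ∈ range t, 𝔑 L G (⟨Klam, CW, G.cE4 + 1, 0⟩ : SplitConsts) Q β U μ (i + 1) Qm ≤ 1 := by
    intro Qm t htn hQt
    have h1 := h𝔑sum L G (⟨Klam, CW, G.cE4 + 1, 0⟩ : SplitConsts) Q β U μ t Qm hG hPWF hQ hU.le hUa1 (htn.trans hn) hQt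
    have h2 : 16 * U * ∑ i ∈ range t, 𝔑 L G (⟨Klam, CW, G.cE4 + 1, 0⟩ : SplitConsts) Q β U μ (i + 1) Qm ≤ 16 * U * (tN * (G.bhi + 1)) :=
      mul_le_mul_of_nonneg_left h1 (by positivity)
    refine h2.trans ?_
    have : 16 * U * (tN * (G.bhi + 1)) = 16 * tN * (G.bhi + 1) * U := by ring
    rw [this]; exact hUN
  have hB1 : PairArrayAtV17F L M (⟨Klam, CW, G.cE4 + 1, 0⟩ : SplitConsts) Q β U μ n :=
    pairArrayAtV17F_of_edgeClauses_explicit L M hG hPWF hQ hU.le hsG hsQ htG htQ hκ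
      (fun j Qm k k' => 𝔛 L M G (⟨Klam, CW, G.cE4 + 1, 0⟩ : SplitConsts) Q β U μ j Qm k k')
      (fun j Qm k k' => h𝔛0 L M G (⟨Klam, CW, G.cE4 + 1, 0⟩ : SplitConsts) Q β U μ j Qm k k' hG hPWF hQ)
      (fun j Qm k k' => h𝔛sup L M G (⟨Klam, CW, G.cE4 + 1, 0⟩ : SplitConsts) Q β U μ j Qm k k' hG hPWF hQ hU.le hUa1 hUX)
      (fun t Qm k k' => h𝔛sum L M G (⟨Klam, CW, G.cE4 + 1, 0⟩ : SplitConsts) Q R β U μ K t n Qm k k' c hG hPWF hQ hR hU.le hUa1 hUR hUX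
        hc hccX hn hKL hHist)
      (fun Qm k k' => h𝔛tot L M G (⟨Klam, CW, G.cE4 + 1, 0⟩ : SplitConsts) Q R β U μ K n Qm k k' c hG hPWF hQ hR hU.le hUa1 hUR hUX
        hc hccX hn hKL hHist)
      (fun j Qm => 𝔑 L G (⟨Klam, CW, G.cE4 + 1, 0⟩ : SplitConsts) Q β U μ j Qm) hnegline
      ((hEall 0 (Nat.zero_le n)).1 rfl)
      (fun j hj1 hjn => (hEall j hjn).2.1 hj1) (fun j hj1 hjn => (hEall j hjn).2.2 hj1)
      hUCR hLline hsmall (by rw [hCW])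
  -- the per-scale step: value line, iso endpoint line, first moments
  have hUD' : (CW' + G.CF * CW' + G.CF * Klam ^ 2) * U ≤ 1 := by rwa [hDval_def] at hUD
  obtain ⟨hKval, harith⟩ := klbs_value_consts hCF hCW'0 hKlam hU.le hUD'
  have hB : BetaSplitAtV17F L M G (⟨Klam, CW, G.cE4 + 1, 0⟩ : SplitConsts) Q β U μ n := by
    have hB0 : 0 ≤ 2 * |U| + (CW + klLegKappa * Q.CR * Klam ^ 3) * U ^ 2 := by
      rw [← hCW'_def]; exact add_nonneg (mul_nonneg zero_le_two (abs_nonneg U)) (mul_nonneg hCW'0 (sq_nonneg U))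
    refine betaSplitAtV17F_of_pairArrayAtV17F L M (⟨Klam, CW, G.cE4 + 1, 0⟩ : SplitConsts) Q hB0 hKlam0 hB1 hEn.2.2.2.2 hEn.2.2.2.1 ?_ ?_ ?_
    · show G.CF * (2 * |U| + (CW + klLegKappa * Q.CR * Klam ^ 3) * U ^ 2) + G.CF * (Klam * U) ^ 2 ≤ Klam * |U|
      rw [hUa, ← hCW'_def]; exact harith
    · show 2 * |U| + (CW + klLegKappa * Q.CR * Klam ^ 3) * U ^ 2 ≤ Klam * |U|
      rw [hUa, ← hCW'_def]; exact hKval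
    · show G.cE4 + Q.cE4 * |U| ≤ G.cE4 + 1
      linarith
  exact hs L M G _ Q β U μ K n hB

end Summit.HubbardSuperconductivity.HubbardSuperconductivity.Theorems.KLRegimeSplit

end
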